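/-
Copyright (c) 2026 the pub-hodgecm-mathlib formalisation cell (harness21).  Prover seat hodgecm-mathlib-R90-C133-p03 (g3), Track B ∕ K2-LIT ∕ R90-TF section S5
(Rogawski Ch. 13.3 ∕ §14.6); CENSUS-γ §4 (RULING S5-R12 (2) «(γ) PAYER SHAPE ADOPTED»): the (γ) COMPOSITION over the named rows, kit-generic, Theorems-side.
-/
import Summits.HodgeConjecture.HodgeConjecture.Theorems.R90S5AeRoutedOfEvpMatch        -- ★ p864070 (this seat): (γ-a) `eventually_clFinChoice_eq_πn_of_evpRepOf_of_evpFin`; brings ★ S9 §8 `evpRepOf`∕`evpFin`, ★ 3w `HomogPacketG`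
import Summits.HodgeConjecture.HodgeConjecture.Theorems.R90S5APacketGOfOneDimU          -- ★ p863612 `GlobalPacketH.imageG` (the image family `Π(P)`); brings ★ W1 `GlobalPacketH.rhoXiU h8U ξ` (`{⟦ξ_v⟧}_v` under (ℓ8ᵁ))
import Literature.NumberTheory.Rogawski1990.GlobalAPacketMembership                   -- ★ D6 `MemXiFamily`
import HarnessLib

/-!
# R90-TF · S5 — `R90S5ATransportOfRows`: THE (γ) LETTER'S COMPOSITION «`t(P) = t(Q)` ∧ `Q = Π(ξ)` ⟹ `P ∈` ξ-envelope» OVER ITS TWO NAMED ROWS (γ1) ∕ (γ2), KIT-GENERIC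
# (Rogawski 1990, Thm. 14.6.4 pp. 243–245 «`Π′ ∈ Π_a(G′)` ⇒ `Π′ = Π′(ξ)`»; §14.6 p. 242; §13.3 p. 201 l. 16)

Cell `hodgecm-mathlib`, crux H413 (`stmt-HodgeConjecture-24833`), route of record `HCCMUnconditional`; programme R90-TF, section S5 (Rogawski Ch. 13.3); RULING S5-R12 (2) of the
S5 dealer R90-C133-plan (g2) 2026-09-05T01:17:33Z (CENSUS-γ §4 adopted: rows (γ0) ★, (γ1) `hEvpXi`, (γ2) `hRigXi`, composition `innerFormATransport₃_of_rows` Lines-side), hand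
R90-C133-p03 (g3).  THEOREMS ONLY (`--kind proof --supports stmt-HodgeConjecture-24833 --as helper`): no `def`, no instance, no notation, no named fact, no `sorry`, NO `Lines`
import; reads no archimedean slot (LAW NO-INF: `Q` enters through `Q.1.fin` only).

WHAT.  The Theorems-side body of A ED. 4's composition, so that the Lines file's `innerFormATransport₃_of_rows` is a one-line call: for a discrete `P` of the inner form `U(H)`,
a coherent homogeneous packet `Q` of a quasi-split kit `𝔩` (S5-C's `PacketGOfRecord` at the record) with the e.v.p. of `P` (★ S9 `evpRepOf L H μ 𝔩 P Q.1.fin` = the token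
`EvpMatch₀`) whose finite part IS `Π(ξ)_f = ξ_H({ξ_v})_v` ((γ0)'s output, ★ C2 :672∕:684 from `IsAPacketOfRecord Q`), the two ROWS
* (γ1) `hEvpXi` «`t(Π′(ξ)) = t(Π(ξ))`» — ★ S9 `evpFin L H 𝔩 (Ξ ξ) (Π(ξ)_f)` for the A-packet family `Ξ ξ` on `U(H)` (record: `xiPacketFamilyOfRecordSCD … ξ`): the (R-c) EVP
  DICTIONARY, a KIT LAW at `rogawskiLocalKit` (JQ-S5→S4-11; owner S4), and
* (γ2) `hRigXi` «a.e. ROUTED through `Π′(ξ)` ⟹ in the ξ-envelope» — `(∀ᶠ v, clFinChoice P v = (Ξ ξ v).πn) → MemXiFamily P hH hHd μω hμu ξ`: the §14.6 organ (S9-B (B4b)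
  re-keyed, XL; owner S9 — its hand-over shape into the envelope is ★ p864181 `memXiFamily_of_keysTrichotomy_of_anisotropic`),
give `MemXiFamily P hH hHd μω hμu ξ` — via ★ p864070 (γ-a) (the two e.v.p. relations against `Q.1.fin` force a.e. routing; level-matching frames `hLM`, discharged ★ at
`H′ = qsForm L`).  Print: Thm. 14.6.4 (`Π′ ∈ Π_a(G′)`, i.e. `t(Π′) = t(Π(ξ))` ⇒ `Π′ = Π′(ξ)`, `Π′(ξ)_v = Π(ξ_v)` for `v ∉ S₀`).
CONTENTS (namespace `Summit.HodgeConjecture.HodgeConjecture.R90.S5`): §1 `memXiFamily_of_evpRepOf_of_fin_eq_of_rows` (finite part given as an equation), **`memXiFamily_of_evpRepOf_imageG_of_rows`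
∕ `exists_…` = RULING S5-R13 (2)'s Q-FREE IMAGE FORM of the letter, verbatim shape** (what pays `stub_R90_S5_A3_aTransport` from the rows), `…_of_loc_eq_of_rows` (placewise,
C2's `LiftsToOfRecord` orientation), `exists_memXiFamily_of_evpRepOf_of_exists_loc_eq_of_rows` (the (γ) letter's `∃ ξ` shape from (γ0)'s `∃ ξ`); §2 the `_qs` versions.
HONEST LABEL: a composition; (γ1) (S4 kit law) and (γ2) (S9, XL) are hypotheses; closes no socket; REL ≠ ★ ≠ BUILT; HC_CM is proved only modulo the 7 printed citations (2 remaining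
named inputs: hLiu418 = stmt-HodgeConjecture-24832, h413 = stmt-HodgeConjecture-24833) until rung 0 closes.

## References
* [Rogawski1990] J. D. Rogawski, *Automorphic Representations of Unitary Groups in Three Variables*, Ann. of Math. Stud. 123 (1990), §13.3 p. 201 l. 16, Thm. 13.3.5 p. 202;
  §14.2 p. 233; §14.6 p. 242 ll. 6–8, (14.6.2)–(14.6.3), Thm. 14.6.4 pp. 243–245.
-/

set_option autoImplicit false
set_option linter.dupNamespace false -- the mandated namespace repeats `HodgeConjecture.HodgeConjecture`, as in every sibling `R90S5*` file

noncomputable section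

open NumberField IsDedekindDomain MeasureTheory Filter
open scoped Matrix
open Literature.NumberTheory Literature.NumberTheory.Automorphic Literature.NumberTheory.Automorphic.UnitaryGroup
open Literature.NumberTheory.Rogawski1990 Literature.NumberTheory.GaloisRepresentations

namespace Summit.HodgeConjecture.HodgeConjecture.R90.S5

open Summit.HodgeConjecture.HodgeConjecture.Cruxes.H413
open Summit.HodgeConjecture.HodgeConjecture.Cruxes.H413.F0P3LocalPacketKit
open Summit.HodgeConjecture.HodgeConjecture.Cruxes.H413.F0P3GlobalPacket
open Summit.HodgeConjecture.HodgeConjecture.Cruxes.H413.F0P3ArchPacketKit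
open Summit.HodgeConjecture.HodgeConjecture.Cruxes.H413.F0P3SpectralPacket
open Summit.HodgeConjecture.HodgeConjecture.Cruxes.H413.F0P3ClassTokenChoice
open Summit.HodgeConjecture.HodgeConjecture.R90.S9

/-! ## §1 The composition, `hLM` a hypothesis (kit over any `H′`) [Thm. 14.6.4; §14.6 p. 242] -/

section Generic

variable (L : Type) [Field L] [NumberField L] [IsCMField L] (H : Matrix (Fin 3) (Fin 3) L) {H' : Matrix (Fin 3) (Fin 3) L}
  (hH : (H.map (cmConjRingHom L))ᵀ = H) (hHd : IsUnit H.det) (μω : HeckeCharacter L) (hμu : μω.IsUnitary)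
  (μ : Measure (adelicGroupData (↥(maximalRealSubfield L)) L (IsCMField.complexConj L) 3 H).automorphicQuotient)
  [(adelicGroupData (↥(maximalRealSubfield L)) L (IsCMField.complexConj L) 3 H).IsAutomorphicMeasure μ]
  (𝔩 : ∀ v : HeightOneSpectrum (𝓞 ↥(maximalRealSubfield L)), LocalPacketKit L H' v)
  (h8U : ∀ v : HeightOneSpectrum (𝓞 ↥(maximalRealSubfield L)), (𝔩 v).OneDimHLawU)
  (hunrU : ∀ ξ : OneDimAutRepH L, ∀ᶠ v : HeightOneSpectrum (𝓞 ↥(maximalRealSubfield L)) in cofinite,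
    (𝔩 v).unr ((𝔩 v).xiH ((GlobalPacketH.rhoXiU h8U ξ).loc v)))
  (Ξ : OneDimAutRepH L → InnerFormSec146.PacketPrimeFin L H)
  (hLM : ∀ᶠ v : HeightOneSpectrum (𝓞 ↥(maximalRealSubfield L)) in cofinite,
    ∃ (T : GL (Fin 3) (LocalRing L v)) (a : LocalRing L v) (ha : IsUnit a)
      (h : formCongr (conjLocal L (IsCMField.complexConj L) v) T (H.map (algebraMap L (LocalRing L v))) = a • H'.map (algebraMap L (LocalRing L v))),
      ∀ g : (cmDatum L 3 H).Local v, (cmDatumLocalCongr L v T ha h).symm g ∈ cmLocalIntegralLevel L 3 H' v ↔ g ∈ cmLocalIntegralLevel L 3 H v)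
  -- (γ1) the (R-c) EVP DICTIONARY «t(Π′(ξ)) = t(Π(ξ))» (S4 kit law, JQ-S5→S4-11)
  (hEvpXi : ∀ ξ : OneDimAutRepH L, InnerFormSec146.evpFin L H 𝔩 (Ξ ξ) ((GlobalPacketH.rhoXiU h8U ξ).imageG (hunrU ξ)))
  -- (γ2) the §14.6 organ, A-branch, envelope currency (S9, XL; hand-over shape ★ p864181)
  (hRigXi : ∀ (P : DiscreteAutomorphicRep (adelicGroupData (↥(maximalRealSubfield L)) L (IsCMField.complexConj L) 3 H) μ) (ξ : OneDimAutRepH L),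
    (∀ᶠ v : HeightOneSpectrum (𝓞 ↥(maximalRealSubfield L)) in cofinite, clFinChoice P v = (Ξ ξ v).πn) → MemXiFamily P hH hHd μω hμu ξ)

include hLM hEvpXi hRigXi

/-- **(γ) COMPOSITION, finite part as an equation**: `t(P) = t(Q_f)` (★ `evpRepOf`) and `Q_f = Π(ξ)_f` (the image family of ★ W1 `rhoXiU h8U ξ`) give `P ∈` ξ-envelope, from the
rows (γ1) `hEvpXi` and (γ2) `hRigXi` through ★ p864070 (γ-a). [cite: Rogawski1990, §14.6 Thm. 14.6.4 pp. 243–245, p. 242 ll. 6–8; §13.3 p. 201 l. 16] -/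
theorem memXiFamily_of_evpRepOf_of_fin_eq_of_rows
    (P : DiscreteAutomorphicRep (adelicGroupData (↥(maximalRealSubfield L)) L (IsCMField.complexConj L) 3 H) μ) (ξ : OneDimAutRepH L) (Pg : GlobalPacket 𝔩)
    (hfin : Pg = (GlobalPacketH.rhoXiU h8U ξ).imageG (hunrU ξ)) (hevp : InnerFormSec146.evpRepOf L H μ 𝔩 P Pg) :
    MemXiFamily P hH hHd μω hμu ξ := by
  subst hfin
  exact hRigXi P ξ (eventually_clFinChoice_eq_πn_of_evpRepOf_of_evpFin L H μ 𝔩 hLM P (Ξ ξ) _ hevp (hEvpXi ξ))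

/-- **(γ) IN THE Q-FREE IMAGE FORM OF RULING S5-R13 (2)** — the payer shape of `InnerFormATransportLetter₃` after «AE-CUT»: a discrete `P` of `U(H)` with
`t(P) = t(Π(ξ′))` (★ `evpRepOf` against the image family of ★ W1 `rhoXiU h8U ξ′`) lies in the ξ′-envelope, from (γ1) + (γ2) (take `ξ := ξ′`).
[cite: Rogawski1990, §14.6 Thm. 14.6.4 pp. 243–245; §13.3 Thm. 13.3.7 pp. 202–203] -/
theorem memXiFamily_of_evpRepOf_imageG_of_rows
    (P : DiscreteAutomorphicRep (adelicGroupData (↥(maximalRealSubfield L)) L (IsCMField.complexConj L) 3 H) μ) (ξ' : OneDimAutRepH L)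
    (hevp : InnerFormSec146.evpRepOf L H μ 𝔩 P ((GlobalPacketH.rhoXiU h8U ξ').imageG (hunrU ξ'))) : MemXiFamily P hH hHd μω hμu ξ' :=
  memXiFamily_of_evpRepOf_of_fin_eq_of_rows L H hH hHd μω hμu μ 𝔩 h8U hunrU Ξ hLM hEvpXi hRigXi P ξ' _ rfl hevp

/-- **The letter's `∃ ξ` conclusion** (S5-R13 (2) verbatim shape: `evpRepOf … P (Π(ξ′)_f) → ∃ ξ, MemXiFamily P … ξ`, witnessed by `ξ := ξ′`). [cite: Rogawski1990, §14.6 Thm. 14.6.4 pp. 243–245] -/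
theorem exists_memXiFamily_of_evpRepOf_imageG_of_rows
    (P : DiscreteAutomorphicRep (adelicGroupData (↥(maximalRealSubfield L)) L (IsCMField.complexConj L) 3 H) μ) (ξ' : OneDimAutRepH L)
    (hevp : InnerFormSec146.evpRepOf L H μ 𝔩 P ((GlobalPacketH.rhoXiU h8U ξ').imageG (hunrU ξ'))) : ∃ ξ : OneDimAutRepH L, MemXiFamily P hH hHd μω hμu ξ :=
  ⟨ξ', memXiFamily_of_evpRepOf_imageG_of_rows L H hH hHd μω hμu μ 𝔩 h8U hunrU Ξ hLM hEvpXi hRigXi P ξ' hevp⟩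

/-- **(γ) COMPOSITION, placewise** (C2's `LiftsToOfRecord` orientation, (γ0)'s output shape `∀ v, Q_v = ξ_H((rhoXiU h8U ξ)_v)`; ★ `GlobalPacket.eq_of_loc_eq`), for a coherent
homogeneous packet `Q` read through `Q.1.fin` only. [cite: Rogawski1990, §14.6 Thm. 14.6.4 pp. 243–245; §13.3 p. 201 ll. 16–18, Thm. 13.3.5 p. 202] -/
theorem memXiFamily_of_evpRepOf_of_loc_eq_of_rows {𝔞 : ArchPacketKit}
    {μqs : Measure (adelicGroupData (↥(maximalRealSubfield L)) L (IsCMField.complexConj L) 3 H').automorphicQuotient}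
    [SMulInvariantMeasure (adelicGroupData (↥(maximalRealSubfield L)) L (IsCMField.complexConj L) 3 H').Adelic
      (adelicGroupData (↥(maximalRealSubfield L)) L (IsCMField.complexConj L) 3 H').automorphicQuotient μqs]
    {infOf : GlobalPacket 𝔩 → 𝔞.PktInf} {aTok : ∀ v : HeightOneSpectrum (𝓞 ↥(maximalRealSubfield L)), Set (𝔩 v).Pkt}
    (P : DiscreteAutomorphicRep (adelicGroupData (↥(maximalRealSubfield L)) L (IsCMField.complexConj L) 3 H) μ)
    (Q : SpectralPacketG.HomogPacketG 𝔩 𝔞 μqs infOf aTok) (ξ : OneDimAutRepH L)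
    (hQ : ∀ v : HeightOneSpectrum (𝓞 ↥(maximalRealSubfield L)), Q.1.fin.loc v = (𝔩 v).xiH ((GlobalPacketH.rhoXiU h8U ξ).loc v))
    (hevp : InnerFormSec146.evpRepOf L H μ 𝔩 P Q.1.fin) : MemXiFamily P hH hHd μω hμu ξ :=
  memXiFamily_of_evpRepOf_of_fin_eq_of_rows L H hH hHd μω hμu μ 𝔩 h8U hunrU Ξ hLM hEvpXi hRigXi P ξ Q.1.fin (GlobalPacket.eq_of_loc_eq hQ) hevp

/-- **THE (γ) LETTER'S SHAPE `∃ ξ, MemXiFamily P … ξ`** from `t(P) = t(Q)` and (γ0)'s `∃ ξ, ∀ v, Q_v = ξ_H((rhoXiU h8U ξ)_v)` (★ C2 `isAPacketOfRecord_iff_exists_packetHOfOneDimU` +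
`LiftsToOfRecord.loc_eq_xiH_rhoXiU` from `IsAPacketOfRecord Q`). [cite: Rogawski1990, §14.6 Thm. 14.6.4 pp. 243–245; §13.3 p. 201 l. 16] -/
theorem exists_memXiFamily_of_evpRepOf_of_exists_loc_eq_of_rows {𝔞 : ArchPacketKit}
    {μqs : Measure (adelicGroupData (↥(maximalRealSubfield L)) L (IsCMField.complexConj L) 3 H').automorphicQuotient}
    [SMulInvariantMeasure (adelicGroupData (↥(maximalRealSubfield L)) L (IsCMField.complexConj L) 3 H').Adelic
      (adelicGroupData (↥(maximalRealSubfield L)) L (IsCMField.complexConj L) 3 H').automorphicQuotient μqs]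
    {infOf : GlobalPacket 𝔩 → 𝔞.PktInf} {aTok : ∀ v : HeightOneSpectrum (𝓞 ↥(maximalRealSubfield L)), Set (𝔩 v).Pkt}
    (P : DiscreteAutomorphicRep (adelicGroupData (↥(maximalRealSubfield L)) L (IsCMField.complexConj L) 3 H) μ)
    (Q : SpectralPacketG.HomogPacketG 𝔩 𝔞 μqs infOf aTok)
    (hA : ∃ ξ : OneDimAutRepH L, ∀ v : HeightOneSpectrum (𝓞 ↥(maximalRealSubfield L)), Q.1.fin.loc v = (𝔩 v).xiH ((GlobalPacketH.rhoXiU h8U ξ).loc v))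
    (hevp : InnerFormSec146.evpRepOf L H μ 𝔩 P Q.1.fin) : ∃ ξ : OneDimAutRepH L, MemXiFamily P hH hHd μω hμu ξ := by
  obtain ⟨ξ, hQ⟩ := hA
  exact ⟨ξ, memXiFamily_of_evpRepOf_of_loc_eq_of_rows L H hH hHd μω hμu μ 𝔩 h8U hunrU Ξ hLM hEvpXi hRigXi P Q ξ hQ hevp⟩

end Generic

/-! ## §2 At the quasi-split form of record `H′ = qsForm L` (`hLM` discharged ★) [§14.2 p. 233] -/

section QS

variable (L : Type) [Field L] [NumberField L] [IsCMField L] (H : Matrix (Fin 3) (Fin 3) L)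
  (hH : (H.map (cmConjRingHom L))ᵀ = H) (hHd : IsUnit H.det) (μω : HeckeCharacter L) (hμu : μω.IsUnitary)
  (μ : Measure (adelicGroupData (↥(maximalRealSubfield L)) L (IsCMField.complexConj L) 3 H).automorphicQuotient)
  [(adelicGroupData (↥(maximalRealSubfield L)) L (IsCMField.complexConj L) 3 H).IsAutomorphicMeasure μ]
  (𝔩 : ∀ v : HeightOneSpectrum (𝓞 ↥(maximalRealSubfield L)), LocalPacketKit L (qsForm L) v)
  (h8U : ∀ v : HeightOneSpectrum (𝓞 ↥(maximalRealSubfield L)), (𝔩 v).OneDimHLawU)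
  (hunrU : ∀ ξ : OneDimAutRepH L, ∀ᶠ v : HeightOneSpectrum (𝓞 ↥(maximalRealSubfield L)) in cofinite,
    (𝔩 v).unr ((𝔩 v).xiH ((GlobalPacketH.rhoXiU h8U ξ).loc v)))
  (Ξ : OneDimAutRepH L → InnerFormSec146.PacketPrimeFin L H)
  (hEvpXi : ∀ ξ : OneDimAutRepH L, InnerFormSec146.evpFin L H 𝔩 (Ξ ξ) ((GlobalPacketH.rhoXiU h8U ξ).imageG (hunrU ξ)))
  (hRigXi : ∀ (P : DiscreteAutomorphicRep (adelicGroupData (↥(maximalRealSubfield L)) L (IsCMField.complexConj L) 3 H) μ) (ξ : OneDimAutRepH L),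
    (∀ᶠ v : HeightOneSpectrum (𝓞 ↥(maximalRealSubfield L)) in cofinite, clFinChoice P v = (Ξ ξ v).πn) → MemXiFamily P hH hHd μω hμu ξ)
  {𝔞 : ArchPacketKit}
  {μqs : Measure (adelicGroupData (↥(maximalRealSubfield L)) L (IsCMField.complexConj L) 3 (qsForm L)).automorphicQuotient}
  [SMulInvariantMeasure (adelicGroupData (↥(maximalRealSubfield L)) L (IsCMField.complexConj L) 3 (qsForm L)).Adelic
    (adelicGroupData (↥(maximalRealSubfield L)) L (IsCMField.complexConj L) 3 (qsForm L)).automorphicQuotient μqs]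
  {infOf : GlobalPacket 𝔩 → 𝔞.PktInf} {aTok : ∀ v : HeightOneSpectrum (𝓞 ↥(maximalRealSubfield L)), Set (𝔩 v).Pkt}

include hEvpXi hRigXi

/-- **(γ) AT THE RECORD FORM, Q-FREE IMAGE FORM (S5-R13 (2))**: `t(P) = t(Π(ξ′))` ⟹ `MemXiFamily P hH hHd μω hμu ξ′`, frames ★-discharged. [cite: Rogawski1990, §14.6 Thm. 14.6.4 pp. 243–245; §14.2 p. 233] -/
theorem memXiFamily_of_evpRepOf_imageG_of_rows_qs
    (P : DiscreteAutomorphicRep (adelicGroupData (↥(maximalRealSubfield L)) L (IsCMField.complexConj L) 3 H) μ) (ξ' : OneDimAutRepH L)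
    (hevp : InnerFormSec146.evpRepOf L H μ 𝔩 P ((GlobalPacketH.rhoXiU h8U ξ').imageG (hunrU ξ'))) : MemXiFamily P hH hHd μω hμu ξ' :=
  memXiFamily_of_evpRepOf_imageG_of_rows L H hH hHd μω hμu μ 𝔩 h8U hunrU Ξ (eventually_exists_cmDatumLocalCongr_levelMatching_all_three L H hH hHd)
    hEvpXi hRigXi P ξ' hevp

/-- **THE (γ) LETTER'S BODY AT THE RECORD FORM (S5-R13 (2) verbatim shape)**: `evpRepOf L H μ 𝔩 P (Π(ξ′)_f) → ∃ ξ, MemXiFamily P hH hHd μω hμu ξ` — what pays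
`stub_R90_S5_A3_aTransport` from the rows (γ1) `hEvpXi` (S4) and (γ2) `hRigXi` (S9). [cite: Rogawski1990, §14.6 Thm. 14.6.4 pp. 243–245; §15.3 ¶1 p. 249] -/
theorem exists_memXiFamily_of_evpRepOf_imageG_of_rows_qs
    (P : DiscreteAutomorphicRep (adelicGroupData (↥(maximalRealSubfield L)) L (IsCMField.complexConj L) 3 H) μ) (ξ' : OneDimAutRepH L)
    (hevp : InnerFormSec146.evpRepOf L H μ 𝔩 P ((GlobalPacketH.rhoXiU h8U ξ').imageG (hunrU ξ'))) : ∃ ξ : OneDimAutRepH L, MemXiFamily P hH hHd μω hμu ξ :=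
  ⟨ξ', memXiFamily_of_evpRepOf_imageG_of_rows_qs L H hH hHd μω hμu μ 𝔩 h8U hunrU Ξ hEvpXi hRigXi P ξ' hevp⟩

/-- **(γ) AT THE RECORD FORM, placewise**: `t(P) = t(Q)` + `∀ v, Q_v = ξ_H((rhoXiU h8U ξ)_v)` ⟹ `MemXiFamily P hH hHd μω hμu ξ` from (γ1) + (γ2); frames ★
`eventually_exists_cmDatumLocalCongr_levelMatching_all_three` (A's frame supplies `hH`, `hHd`). [cite: Rogawski1990, §14.6 Thm. 14.6.4 pp. 243–245; §14.2 p. 233] -/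
theorem memXiFamily_of_evpRepOf_of_loc_eq_of_rows_qs
    (P : DiscreteAutomorphicRep (adelicGroupData (↥(maximalRealSubfield L)) L (IsCMField.complexConj L) 3 H) μ)
    (Q : SpectralPacketG.HomogPacketG 𝔩 𝔞 μqs infOf aTok) (ξ : OneDimAutRepH L)
    (hQ : ∀ v : HeightOneSpectrum (𝓞 ↥(maximalRealSubfield L)), Q.1.fin.loc v = (𝔩 v).xiH ((GlobalPacketH.rhoXiU h8U ξ).loc v))
    (hevp : InnerFormSec146.evpRepOf L H μ 𝔩 P Q.1.fin) : MemXiFamily P hH hHd μω hμu ξ :=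
  memXiFamily_of_evpRepOf_of_loc_eq_of_rows L H hH hHd μω hμu μ 𝔩 h8U hunrU Ξ (eventually_exists_cmDatumLocalCongr_levelMatching_all_three L H hH hHd)
    hEvpXi hRigXi P Q ξ hQ hevp

/-- **THE (γ) LETTER AT THE RECORD FORM**: `EvpMatch₀ P Q` (`:= evpRepOf L H μ 𝔩 P Q.1.fin`) + (γ0)'s `∃ ξ, ∀ v, Q_v = ξ_H((rhoXiU h8U ξ)_v)` ⟹ `∃ ξ, MemXiFamily P hH hHd μω hμu ξ` — the body
of A ED. 4's `innerFormATransport₃_of_rows`, modulo the two named rows. [cite: Rogawski1990, §14.6 Thm. 14.6.4 pp. 243–245; §15.3 ¶1 p. 249] -/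
theorem exists_memXiFamily_of_evpRepOf_of_exists_loc_eq_of_rows_qs
    (P : DiscreteAutomorphicRep (adelicGroupData (↥(maximalRealSubfield L)) L (IsCMField.complexConj L) 3 H) μ)
    (Q : SpectralPacketG.HomogPacketG 𝔩 𝔞 μqs infOf aTok)
    (hA : ∃ ξ : OneDimAutRepH L, ∀ v : HeightOneSpectrum (𝓞 ↥(maximalRealSubfield L)), Q.1.fin.loc v = (𝔩 v).xiH ((GlobalPacketH.rhoXiU h8U ξ).loc v))
    (hevp : InnerFormSec146.evpRepOf L H μ 𝔩 P Q.1.fin) : ∃ ξ : OneDimAutRepH L, MemXiFamily P hH hHd μω hμu ξ :=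
  exists_memXiFamily_of_evpRepOf_of_exists_loc_eq_of_rows L H hH hHd μω hμu μ 𝔩 h8U hunrU Ξ (eventually_exists_cmDatumLocalCongr_levelMatching_all_three L H hH hHd)
    hEvpXi hRigXi P Q hA hevp

end QS

end Summit.HodgeConjecture.HodgeConjecture.R90.S5

end
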